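import Summits.MatrixMultiplication.MatrixMultiplication.Theorems.SoloBlindChainLemma

/-!
# Solo-blind seat (MatrixMultiplication), s71 — the Comb Lemma, realisability direction (paper/KraftK3.md §7.12, K3.12.15 (R4))

By the Network Structure Theorem (K3.12.15) every obstruction to a frame being good on a set is an `𝔽₃`-combination of axis lines, and
summing the line identity `lineSum_eq_neg` (`SoloBlindLineIdentity`) over such a network supported in a level set of `F = Q + ℓ` forces the
VALUE RELATION `Σ_L c_L · Q(dir L) = 0`.  The COMB network — a spine line in direction `s` (coefficient `−1`) with three teeth in directions
`a, b, c` (coefficient `+1`) through its three points `s, 0, −s` — has support the six tooth ends `s ± a, ±b, −s ± c` and relation vector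
`e_a + e_b + e_c − e_s`.  This file certifies the realisability direction: if `Q a + Q b + Q c = Q s` then, for the explicit linear part
below, all six tooth ends lie in the level set `{Q + ℓ = Q b}` — so a frame whose values satisfy a relation of type (4,1) is never universal
(companion of `chain3_realise`, `chain4_realise` in `SoloBlindChainLemma`).  Pure algebra over `ZMod 3`; no `ω` content.
-/

set_option linter.dupNamespace false
set_option autoImplicit false

namespace Summit.MatrixMultiplication.MatrixMultiplication.Theorems

variable {M N : Type*} [AddCommGroup M] [Module (ZMod 3) M] [AddCommGroup N] [Module (ZMod 3) N]

/-- COMB LEMMA, realisability: spine direction `s`, teeth `a` (at `s`), `b` (at `0`), `c` (at `-s`).  With `ℓ b = 0`,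
`ℓ a = - polar Q s a`, `ℓ c = polar Q s c`, `ℓ s = Q b - Q s - Q a` and the (4,1) relation `Q a + Q b + Q c = Q s`, the six tooth ends
`s ± a`, `±b`, `-s ± c` all lie in `{Q + ℓ = Q b}`. -/
theorem comb_realise (Q : QuadraticMap (ZMod 3) M N) (ℓ : M →ₗ[ZMod 3] N) (s a b c : M)
    (hb : ℓ b = 0) (ha : ℓ a = -QuadraticMap.polar Q s a) (hc : ℓ c = QuadraticMap.polar Q s c)
    (hs : ℓ s = Q b - Q s - Q a) (hrel : Q a + Q b + Q c = Q s) :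
    Q (s + a) + ℓ (s + a) = Q b ∧ Q (s - a) + ℓ (s - a) = Q b ∧ Q b + ℓ b = Q b ∧ Q (-b) + ℓ (-b) = Q b ∧
      Q (-s + c) + ℓ (-s + c) = Q b ∧ Q (-s - c) + ℓ (-s - c) = Q b := by
  have ea := three_smul_eq_zero_zmod3 (Q a)
  have ec := three_smul_eq_zero_zmod3 (Q c)
  have hs' : Q s = Q a + Q b + Q c := hrel.symm
  refine ⟨?_, ?_, ?_, ?_, ?_, ?_⟩
  · rw [QuadraticMap.map_add Q s a, map_add, ha, hs]; abel
  · rw [sub_eq_add_neg s a, QuadraticMap.map_add Q s (-a), QuadraticMap.map_neg, QuadraticMap.polar_neg_right, map_add, map_neg,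
      ha, hs]; abel
  · rw [hb, add_zero]
  · rw [QuadraticMap.map_neg, map_neg, hb, neg_zero, add_zero]
  · rw [QuadraticMap.map_add Q (-s) c, QuadraticMap.map_neg, QuadraticMap.polar_neg_left, map_add, map_neg, hc, hs, hs']
    linear_combination (norm := skip) ea + ec
    match_scalars <;> decide
  · rw [sub_eq_add_neg (-s) c, QuadraticMap.map_add Q (-s) (-c), QuadraticMap.map_neg, QuadraticMap.map_neg,
      QuadraticMap.polar_neg_left, QuadraticMap.polar_neg_right, map_add, map_neg, map_neg, hc, hs, hs']
    linear_combination (norm := skip) ea + ec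
    match_scalars <;> decide

end Summit.MatrixMultiplication.MatrixMultiplication.Theorems
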